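import Literature.AlgebraicGeometry.ModuliOfAbelianVarieties.SiegelFamilyHumbertHeckeTransport
import Literature.AlgebraicGeometry.ModuliOfAbelianVarieties.SiegelFamilyHumbertSquareInvariantDegrees
import HarnessLib

/-!
# `T(n)(H_1) ⊆ H_{n²}`: a principally polarised abelian surface joined to a product of elliptic curves by a polarised
# isogeny of multiplier `n` lies on the Humbert surface `H_{n²}` and contains an elliptic curve of degree dividing `n`

Layer `Literature/AlgebraicGeometry/ModuliOfAbelianVarieties`, namespace
`Literature.AlgebraicGeometry.ModuliOfAbelianVarieties.SiegelModuli`; lane `lit-hodgefound` (Track 2, Layer A4), seat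
`lit-hodgefound-skel-4` (generation 56), row A4-203 of `run/shared/lean/pub/lit-hodgefound/SKELETON.md`.  The case `Δ = 1`
of row A4-202 (`SiegelFamilyHumbertHeckeTransport`: `T(n)(H_Δ) ⊆ H_{n²Δ}`) joined to rows A4-60 ∕ 60′
(`SiegelFamilyHumbertSquareInvariant` ∕ `…Degrees`: `H_1 ∋` every diagonal `Z`, i.e. every product `E_{z₁₁} × E_{z₂₂}` with
its product polarisation; `Z ∈ H_{δ²} ⟺ X_Z` contains an elliptic curve of degree `δ' ∣ δ`).  Consumed BY NAME: A4-202
`mem_humbertLocusOfInvariant_sq_mul_of_mem_heckeSet` ∕ `mem_humbertLocusOfInvariant_sq_mul_of_mem_of_mem_heckeSet`,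
A4-60 `mem_humbertLocusOfInvariant_one_of_apply_eq_zero`, A4-60′
`mem_humbertLocusOfInvariant_sq_iff_exists_ellipticCurve_degree_dvd`.  THEOREMS ONLY (D-0026: no definition, no instance,
no named fact; net debt `0`).

## Sources, verbatim

* Ch. Birkenhake, H. Wilhelm, *Humbert surfaces and the Kummer plane*, Trans. AMS 355 (2003) [BirkenhakeWilhelm2003], §1
  (∗) (p. 1819) (the loci `H_Δ`); §4 Prop. 4.8 and its proof (p. 1830): «`deg L₀|E₁ = δ`» … «with some divisor `δ′` of `δ`
  … `(X, L₀) ∈ H_{(δ′)²} ⊆ H_{δ²}`» (`H_{δ²}` = surfaces containing an elliptic curve of degree dividing `δ`; `H_1` =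
  products of elliptic curves).
* E. Kani, *Curves of genus 2 on abelian surfaces* [KaniCurvesGenus2AbelianSurfaces], §2 (11) (chunk p0005) (the refined
  Humbert invariant, through which row A4-202 transports `H_Δ`); E. Kani, *Elliptic curves on abelian surfaces*,
  Manuscripta Math. 84 (1994) [Kani1994EllipticCurvesAbelianSurfaces]; G. Frey, E. Kani, *Curves of genus 2 covering
  elliptic curves and an arithmetical application* (1991) [FreyKani1991] (genus-`2` curves with an elliptic subcover of
  degree `n` ↔ Jacobians `(n, n)`-isogenous to a product `E × E′`).
* H. Lange, *Abelian Varieties over the Complex Numbers* (2023) [held text `book:lange1992-complex-abelian-varieties`],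
  §1.7.2 Cor. 1.7.6 (p0073), §2.1.1 Cor. 2.1.4.
* G. van der Geer, *Siegel modular forms and their applications* (2008), §16 (p0253 L21) (the correspondences `T(n)`).

DEVIATION (said once).  Birkenhake–Wilhelm print `H_1` = products and `H_{δ²}` = «contains an elliptic curve of degree
`δ′ ∣ δ`» (Prop. 4.8); Frey–Kani ∕ Kani relate elliptic subcovers of degree `n` to `(n, n)`-isogenies with a product.  The
file proves, on the Siegel family and for the NON-PRIMITIVE loci of row A4-60, the composite ONE-WAY statement: every
member of `T(n)(Z')` for a product point `Z'` (`z′₁₂ = 0`, or any `Z' ∈ H_1`) lies on `H_{n²}`, hence contains an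
elliptic curve of degree dividing `n`; and symmetrically a point with a member of `T(n)` that is a product lies on
`H_{n²}`.  The converse (Kani: `H_{N²}` primitive ⟹ an `(N, N)`-isogeny to a product) is not claimed.

## What is proved

* **`mem_humbertLocusOfInvariant_sq_of_mem_one_of_mem_heckeSet`** (`Z' ∈ H_1`, `Z ∈ T(n)(Z')` ⟹ `Z ∈ H_{n²}`),
  **`mem_humbertLocusOfInvariant_sq_of_apply_eq_zero_of_mem_heckeSet`** (`z′₁₂ = 0`: `X_{Z'} = E_{z′₁₁} × E_{z′₂₂}`),
  `mem_humbertLocusOfInvariant_sq_of_mem_heckeSet_of_apply_eq_zero` (the member is the product: `Z ∈ T(n)(Z')`, `z₁₂ = 0`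
  ⟹ `Z' ∈ H_{n²}`), **`exists_ellipticCurve_degree_dvd_of_mem_heckeSet`** (`Z' ∈ H_1`, `Z ∈ T(n)(Z')` ⟹ `X_Z` contains an
  elliptic curve — a rank-`2` complex subtorus `Y` — of degree `(Y · θ_Z) = δ′` with `0 < δ′ ∣ n`),
  `exists_ellipticCurve_degree_dvd_of_apply_eq_zero_of_mem_heckeSet`.

## References

* [BirkenhakeWilhelm2003] Ch. Birkenhake, H. Wilhelm, Trans. AMS 355 (2003) 1819–1841, §1 (∗), §4 Prop. 4.8 (p. 1830).
* [KaniCurvesGenus2AbelianSurfaces] E. Kani, *Curves of genus 2 on abelian surfaces*, §2 (11).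
* [Kani1994EllipticCurvesAbelianSurfaces] E. Kani, Manuscripta Math. 84 (1994) 199–223.
* [FreyKani1991] G. Frey, E. Kani, in *Arithmetic Algebraic Geometry*, Birkhäuser (1991) 153–176.
* [Lange2023AbelianVarietiesComplex] H. Lange, Springer (2023), §1.7.2 Cor. 1.7.6 (p0073), §2.1.1 Cor. 2.1.4.
* [vanderGeer2008] G. van der Geer, in *The 1-2-3 of Modular Forms*, Springer (2008), §16 (p. 253 L21).
-/

noncomputable section

open Matrix Module Function Set Sum
open scoped Matrix

namespace Literature.AlgebraicGeometry.ModuliOfAbelianVarieties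

namespace SiegelModuli

open Literature.NumberTheory.Automorphic (siegelUpperHalfSpace)
open Literature.NumberTheory.ModularForms Literature.NumberTheory.ModularForms.SiegelUpperHalfSpace
open Literature.NumberTheory.ComplexMultiplication
open Literature.Geometry.Kaehler Literature.Geometry.Kaehler.ComplexTorus

variable {Z Z' : siegelUpperHalfSpace 2} {n : ℕ}

/-- **`T(n)(H_1) ⊆ H_{n²}`**: `Z' ∈ H_1` and `Z ∈ T(n)(Z')` (`n ≥ 1`) ⟹ `Z ∈ H_{n²}` — row A4-202 at `Δ = 1`.
[cite: BirkenhakeWilhelm2003, §1 (∗) (p. 1819) and §4 Prop. 4.8 (p. 1830)] [cite: FreyKani1991]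
[cite: KaniCurvesGenus2AbelianSurfaces, §2 (11) (chunk p0005)] [cite: Lange2023AbelianVarietiesComplex, §1.7.2 Cor. 1.7.6 (p0073)] -/
theorem mem_humbertLocusOfInvariant_sq_of_mem_one_of_mem_heckeSet (hn : n ≠ 0)
    (hZ' : Z' ∈ humbertLocusOfInvariant 1)
    (hZ : ∃ A : Matrix (Fin 2 ⊕ Fin 2) (Fin 2 ⊕ Fin 2) ℤ, IsIsogeny (prinPeriod Z') (prinPeriod Z) A ∧
      (prinForm Z).compContinuousLinearMap (realRep (prinPeriod Z') (prinPeriod Z) A) = (n : ℝ) • prinForm Z') :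
    Z ∈ humbertLocusOfInvariant ((n : ℤ) ^ 2) := by
  have h := mem_humbertLocusOfInvariant_sq_mul_of_mem_heckeSet hn hZ' hZ
  rwa [mul_one] at h

/-- **A SURFACE JOINED TO A PRODUCT `E_{z′₁₁} × E_{z′₂₂}` BY A POLARISED ISOGENY OF MULTIPLIER `n` LIES ON `H_{n²}`**:
`z′₁₂ = 0` (so `X_{Z'}` is the product of two elliptic curves with its product principal polarisation, a point of `H_1`,
row A4-60) and `Z ∈ T(n)(Z')` ⟹ `Z ∈ H_{n²}` — the Humbert surface of the `(n, n)`-split surfaces.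
[cite: BirkenhakeWilhelm2003, §4 Prop. 4.8 (pp. 1830–1831)] [cite: FreyKani1991] [cite: vanderGeer2008, §16 (p. 253 L21)]
[cite: KaniCurvesGenus2AbelianSurfaces, §2 (11) (chunk p0005)] -/
theorem mem_humbertLocusOfInvariant_sq_of_apply_eq_zero_of_mem_heckeSet (hn : n ≠ 0)
    (h : (Z' : Matrix (Fin 2) (Fin 2) ℂ) 0 1 = 0)
    (hZ : ∃ A : Matrix (Fin 2 ⊕ Fin 2) (Fin 2 ⊕ Fin 2) ℤ, IsIsogeny (prinPeriod Z') (prinPeriod Z) A ∧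
      (prinForm Z).compContinuousLinearMap (realRep (prinPeriod Z') (prinPeriod Z) A) = (n : ℝ) • prinForm Z') :
    Z ∈ humbertLocusOfInvariant ((n : ℤ) ^ 2) := by
  have h1 := mem_humbertLocusOfInvariant_one_of_apply_eq_zero Z' h
  rw [one_pow] at h1
  exact mem_humbertLocusOfInvariant_sq_of_mem_one_of_mem_heckeSet hn h1 hZ

/-- The same read from the member: `Z ∈ T(n)(Z')` with `X_Z = E_{z₁₁} × E_{z₂₂}` a product (`z₁₂ = 0`) ⟹ `Z' ∈ H_{n²}`
(the isogeny `A : X_{Z'} → X_Z` to the product pulls `NS(X_Z)` back, row A4-202).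
[cite: BirkenhakeWilhelm2003, §4 Prop. 4.8 (pp. 1830–1831)] [cite: FreyKani1991] [cite: Lange2023AbelianVarietiesComplex, §2.1.1 Cor. 2.1.4] -/
theorem mem_humbertLocusOfInvariant_sq_of_mem_heckeSet_of_apply_eq_zero (hn : n ≠ 0)
    (hZ : ∃ A : Matrix (Fin 2 ⊕ Fin 2) (Fin 2 ⊕ Fin 2) ℤ, IsIsogeny (prinPeriod Z') (prinPeriod Z) A ∧
      (prinForm Z).compContinuousLinearMap (realRep (prinPeriod Z') (prinPeriod Z) A) = (n : ℝ) • prinForm Z')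
    (h : (Z : Matrix (Fin 2) (Fin 2) ℂ) 0 1 = 0) : Z' ∈ humbertLocusOfInvariant ((n : ℤ) ^ 2) := by
  have h1 := mem_humbertLocusOfInvariant_one_of_apply_eq_zero Z h
  rw [one_pow] at h1
  have h2 := mem_humbertLocusOfInvariant_sq_mul_of_mem_of_mem_heckeSet hn hZ h1
  rwa [mul_one] at h2

/-- **… AND CONTAINS AN ELLIPTIC CURVE OF DEGREE DIVIDING `n`**: for `Z' ∈ H_1` and `Z ∈ T(n)(Z')` (`n ≥ 1`) the surface
`X_Z` contains a rank-`2` complex subtorus `Y` — an elliptic curve — of degree `(Y · θ_Z) = δ′` with `0 < δ′ ∣ n`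
(Prop. 4.8: «with some divisor `δ′` of `δ` … `(X, L₀) ∈ H_{(δ′)²} ⊆ H_{δ²}`», row A4-60′).
[cite: BirkenhakeWilhelm2003, §4 Prop. 4.8 and its proof (p. 1830)] [cite: Kani1994EllipticCurvesAbelianSurfaces] [cite: FreyKani1991] -/
theorem exists_ellipticCurve_degree_dvd_of_mem_heckeSet (hn : n ≠ 0) (hZ' : Z' ∈ humbertLocusOfInvariant 1)
    (hZ : ∃ A : Matrix (Fin 2 ⊕ Fin 2) (Fin 2 ⊕ Fin 2) ℤ, IsIsogeny (prinPeriod Z') (prinPeriod Z) A ∧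
      (prinForm Z).compContinuousLinearMap (realRep (prinPeriod Z') (prinPeriod Z) A) = (n : ℝ) • prinForm Z') :
    ∃ (Y : SubtorusFrame (prinPeriod Z : (Fin 2 ⊕ Fin 2 → ℝ) ≃L[ℝ] (Fin 2 → ℂ)) 2) (δ' : ℤ), 0 < δ' ∧ δ' ∣ (n : ℤ) ∧
      (δ' : ℝ) = -prinForm Z ![latticeVec (prinPeriod Z) (Y.frame 0), latticeVec (prinPeriod Z) (Y.frame 1)] :=
  (mem_humbertLocusOfInvariant_sq_iff_exists_ellipticCurve_degree_dvd Z (Int.natCast_pos.2 (Nat.pos_of_ne_zero hn))).1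
    (mem_humbertLocusOfInvariant_sq_of_mem_one_of_mem_heckeSet hn hZ' hZ)

/-- The same for a product point `Z'` (`z′₁₂ = 0`): every member of `T(n)(E_{z′₁₁} × E_{z′₂₂})` contains an elliptic curve
of degree dividing `n`. [cite: BirkenhakeWilhelm2003, §4 Prop. 4.8 and its proof (p. 1830)] [cite: FreyKani1991]
[cite: Kani1994EllipticCurvesAbelianSurfaces] -/
theorem exists_ellipticCurve_degree_dvd_of_apply_eq_zero_of_mem_heckeSet (hn : n ≠ 0)
    (h : (Z' : Matrix (Fin 2) (Fin 2) ℂ) 0 1 = 0)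
    (hZ : ∃ A : Matrix (Fin 2 ⊕ Fin 2) (Fin 2 ⊕ Fin 2) ℤ, IsIsogeny (prinPeriod Z') (prinPeriod Z) A ∧
      (prinForm Z).compContinuousLinearMap (realRep (prinPeriod Z') (prinPeriod Z) A) = (n : ℝ) • prinForm Z') :
    ∃ (Y : SubtorusFrame (prinPeriod Z : (Fin 2 ⊕ Fin 2 → ℝ) ≃L[ℝ] (Fin 2 → ℂ)) 2) (δ' : ℤ), 0 < δ' ∧ δ' ∣ (n : ℤ) ∧
      (δ' : ℝ) = -prinForm Z ![latticeVec (prinPeriod Z) (Y.frame 0), latticeVec (prinPeriod Z) (Y.frame 1)] := by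
  have h1 := mem_humbertLocusOfInvariant_one_of_apply_eq_zero Z' h
  rw [one_pow] at h1
  exact exists_ellipticCurve_degree_dvd_of_mem_heckeSet hn h1 hZ

end SiegelModuli

end Literature.AlgebraicGeometry.ModuliOfAbelianVarieties

end
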